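import Mathlib

/-!
# Tier3LagrangianGraph — Lagrangians of the doubled space of an anisotropic form are graphs of isometries
(T3.5 for T3.1; PERIOD-ADDENDUM-9 §A9.3 step 2 and PERIOD.md §4.6)

The doubling method unfolds the Piatetski-Shapiro–Rallis zeta integral over the orbits of `U(W) × U(W)` on
`P \ U(W ⊕ W⁻)` = the set of Lagrangian (maximal totally isotropic) subspaces of `W ⊕ W⁻`.  When `W` is
ANISOTROPIC (the route's `W = W₀ ⊕ W₁`, definite at `w₀`) there is exactly ONE orbit: a Lagrangian meets neither
summand, hence is the graph of a linear map `W → W`, and total isotropy makes that map an isometry; conversely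
the graph of an isometry is a Lagrangian, and `(g₁, g₂)` carries the graph of `α` to the graph of `g₂ ∘ α ∘ g₁⁻¹`,
so all Lagrangians are in one orbit.  This file is that linear algebra, for an arbitrary pairing
`B : V → V → K` with `B 0 0 = 0` that is anisotropic (`B v v = 0 → v = 0`) — bilinear AND hermitian forms alike;
the doubled form is `D((v, w), (v', w')) = B v v' − B w w'`, and «`Λ` totally isotropic for `D`» is written
out as `∀ x ∈ Λ, ∀ y ∈ Λ, B x.1 y.1 = B x.2 y.2`.  No definition, no notation, `import Mathlib` only.
Nothing here asserts anything about the original programme; HC_CM is NOT proved by anyone in this repository.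
-/

namespace HodgeRepro.T3P1.LagrangianGraph

variable {K V : Type*} [Field K] [AddCommGroup V] [Module K V]

/-- A totally isotropic subspace of the doubled space meets `V × 0` and `0 × V` trivially: its elements are
determined by their first coordinate. -/
theorem eq_zero_of_fst_eq_zero (B : V → V → K) (hB0 : B 0 0 = 0) (hB : ∀ v, B v v = 0 → v = 0)
    (Λ : Submodule K (V × V)) (hiso : ∀ x ∈ Λ, ∀ y ∈ Λ, B x.1 y.1 = B x.2 y.2)
    {x : V × V} (hx : x ∈ Λ) (h1 : x.1 = 0) : x = 0 := by
  have h := hiso x hx x hx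
  rw [h1, hB0] at h
  have h2 : x.2 = 0 := hB _ h.symm
  exact Prod.ext h1 h2

/-- The first projection restricted to a totally isotropic subspace is injective. -/
theorem fst_injective (B : V → V → K) (hB0 : B 0 0 = 0) (hB : ∀ v, B v v = 0 → v = 0)
    (Λ : Submodule K (V × V)) (hiso : ∀ x ∈ Λ, ∀ y ∈ Λ, B x.1 y.1 = B x.2 y.2) :
    Function.Injective ((LinearMap.fst K V V).comp Λ.subtype) := by
  rw [← LinearMap.ker_eq_bot, LinearMap.ker_eq_bot']
  intro x hx
  have : (x : V × V) = 0 :=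
    eq_zero_of_fst_eq_zero B hB0 hB Λ hiso x.2 (by simpa using hx)
  exact Subtype.ext this

/-- **A Lagrangian of the doubled space is the graph of an isometry.** If `V` is finite-dimensional, `B` is
anisotropic, and `Λ ≤ V × V` is totally isotropic for `D = B ⊕ (−B)` with `dim Λ = dim V`, then there is a
linear `α : V → V` preserving `B` whose graph is `Λ`. -/
theorem exists_isometry_graph_eq [FiniteDimensional K V] (B : V → V → K) (hB0 : B 0 0 = 0)
    (hB : ∀ v, B v v = 0 → v = 0) (Λ : Submodule K (V × V))
    (hiso : ∀ x ∈ Λ, ∀ y ∈ Λ, B x.1 y.1 = B x.2 y.2)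
    (hdim : Module.finrank K Λ = Module.finrank K V) :
    ∃ α : V →ₗ[K] V, (∀ v w, B (α v) (α w) = B v w) ∧ Λ = LinearMap.graph α := by
  set f : Λ →ₗ[K] V := (LinearMap.fst K V V).comp Λ.subtype with hf
  have hinj : Function.Injective f := fst_injective B hB0 hB Λ hiso
  have hsurj : Function.Surjective f :=
    (LinearMap.injective_iff_surjective_of_finrank_eq_finrank hdim).mp hinj
  set e : Λ ≃ₗ[K] V := LinearEquiv.ofBijective f ⟨hinj, hsurj⟩ with he
  have he_apply : ∀ x : Λ, e x = (x : V × V).1 := fun x => rfl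
  set α : V →ₗ[K] V := (LinearMap.snd K V V).comp (Λ.subtype.comp e.symm.toLinearMap) with hα
  have hα_apply : ∀ v, α v = ((e.symm v : Λ) : V × V).2 := fun v => rfl
  -- the element of `Λ` over `v`
  have hover : ∀ v, ((e.symm v : Λ) : V × V).1 = v := by
    intro v
    have := he_apply (e.symm v)
    rw [LinearEquiv.apply_symm_apply] at this
    exact this.symm
  have hgraph : Λ = LinearMap.graph α := by
    ext x
    rw [LinearMap.mem_graph_iff]
    constructor
    · intro hx
      have hsym : e.symm x.1 = ⟨x, hx⟩ := by
        apply e.injective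
        rw [LinearEquiv.apply_symm_apply, he_apply]
      rw [hα_apply, hsym]
    · intro hx
      have hx' : x = ((e.symm x.1 : Λ) : V × V) := by
        refine Prod.ext ?_ ?_
        · exact (hover x.1).symm
        · rw [hx, hα_apply]
      rw [hx']
      exact (e.symm x.1).2
  refine ⟨α, ?_, hgraph⟩
  intro v w
  have hv : (v, α v) ∈ Λ := by rw [hgraph, LinearMap.mem_graph_iff]
  have hw : (w, α w) ∈ Λ := by rw [hgraph, LinearMap.mem_graph_iff]
  exact (hiso _ hv _ hw).symm

/-- Conversely, the graph of an isometry is totally isotropic for the doubled form. -/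
theorem graph_isotropic (B : V → V → K) (α : V →ₗ[K] V) (hα : ∀ v w, B (α v) (α w) = B v w) :
    ∀ x ∈ LinearMap.graph α, ∀ y ∈ LinearMap.graph α, B x.1 y.1 = B x.2 y.2 := by
  intro x hx y hy
  rw [LinearMap.mem_graph_iff] at hx hy
  rw [hx, hy, hα]

/-- The graph of any linear map has the dimension of the source. -/
theorem finrank_graph [FiniteDimensional K V] (α : V →ₗ[K] V) :
    Module.finrank K (LinearMap.graph α) = Module.finrank K V := by
  rw [LinearMap.graph_eq_range_prod]
  apply LinearMap.finrank_range_of_inj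
  intro v w h
  simpa using congrArg Prod.fst h

/-- An isometry of an anisotropic form is injective, hence (finite dimension) bijective. -/
theorem isometry_injective (B : V → V → K) (hB0 : B 0 0 = 0) (hB : ∀ v, B v v = 0 → v = 0)
    (α : V →ₗ[K] V) (hα : ∀ v w, B (α v) (α w) = B v w) : Function.Injective α := by
  rw [← LinearMap.ker_eq_bot, LinearMap.ker_eq_bot']
  intro v hv
  apply hB
  rw [← hα v v, hv, hB0]

/-- **One orbit.** `(g₁, g₂)` carries the graph of `α` to the graph of `g₂ ∘ α ∘ g₁⁻¹`: the graphs of all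
isometries lie in one orbit of pairs of automorphisms of `V` (for the route: `U(W) × U(W)` acts transitively on
the Lagrangians of `W ⊕ W⁻`, `P(E′⁺) \ U(W ⊕ W⁻)(E′⁺) ≅ U(W)(E′⁺)`). -/
theorem map_prodMap_graph (α : V →ₗ[K] V) (g₁ g₂ : V ≃ₗ[K] V) :
    Submodule.map (LinearMap.prodMap (g₁ : V →ₗ[K] V) (g₂ : V →ₗ[K] V)) (LinearMap.graph α)
      = LinearMap.graph ((g₂ : V →ₗ[K] V).comp (α.comp (g₁.symm : V →ₗ[K] V))) := by
  ext x
  rw [Submodule.mem_map, LinearMap.mem_graph_iff]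
  constructor
  · rintro ⟨y, hy, rfl⟩
    rw [LinearMap.mem_graph_iff] at hy
    simp [hy]
  · intro hx
    refine ⟨(g₁.symm x.1, α (g₁.symm x.1)), ?_, ?_⟩
    · rw [LinearMap.mem_graph_iff]
    · refine Prod.ext ?_ ?_
      · simp
      · simpa using hx.symm

end HodgeRepro.T3P1.LagrangianGraph
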